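import Summits.BirchSwinnertonDyer.BirchSwinnertonDyer.Theorems.KimAtThreeDeepLowerOffStratumLevelLoweringVatsalStabRows
import Literature.NumberTheory.GaloisRepresentations.TeichmullerCharacter
import HarnessLib

/-!
# Route `KimAtThreeKolyvagin` (rung W2), crux `DeepLowerAtThreeOffKatoStratum` (item 19679), registered
# stub `stub_nonAdditive`, ROAD (b): THEOREM B′ — the Tamagawa-`3` prime `q` ADDITIVE for `E` (Kodaira IV/IV*,
# `q ∣ N/q`): the `U_q`-depleted old form `ι₁ g − a_q(g)·ι_q g` and the covered rows

Cell `bsd-addord`, seat `bsd-addord-w2-acc2` (PROGRAMME PART 1b, ACCEL-LIST row (2)), gen 4; item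
`stmt-BirchSwinnertonDyer-19679` (OWNER w2-c2 assembles; `--supports`, closes nothing). Companion of
`…VatsalStab` / `…VatsalStabRows` (the case `q ∤ N/q`, `q` split multiplicative: `q`-STABILISATION by a root `β ≡ q`
of `X² − a_q(g)X + q`). When the Tamagawa-`3` prime `q ≠ 3` is ADDITIVE for `E` (Kodaira type IV or IV*,
`c_q = 3`, `q² ∣ N_E`), `ρ̄_{E,3}` has Serre conductor exponent `1` at `q` (tame unipotent inertia), Ribet's
newform `g` has level `M = N_E/q` with `q ∥ M`, `U_q g = a_q(g) g`, `a_q(g) = ±1`, and the congruent level-`N_E`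
eigenform is the `U_q`-DEPLETION `g' = ι₁ g − a_q(g)·ι_q g` (`U_q g' = 0 = a_q(E)·g'`). Theorems only:

* §1 `heckeT_stab_self_of_dvd` (`U_q g' = 0` for `q ∣ M`: `a_{qn}(g) = a_q(g) aₙ(g)`), `isHeckeEigenform_stab_of_dvd`
  (`T_ℓ`, `ℓ ≠ q`, is `…VatsalStab.heckeT_stab_of_ne`, valid for any `β`), `finiteDimensional_coeffField_stab_of_mem`
  (`K_{g'} ⊆ K_g` since `β = a_q(g) ∈ K_g`).
* §2 ★ `isStabilisedLevelLoweringCongruenceIn_three_of_levelLoweredNewform_of_dvd` — (LL_1) over `𝓀` from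
  `vatsal1999_/greenbergVatsal2000_plusSymbol_congruence` BY NAME + a level-`M` newform `g` (`q ∣ M`) with
  `a_ℓ(g) ≡ a_ℓ(D₀.f)` at the primes `ℓ ≠ q` + `a_q(E) = 0` + the DISPLAYED LOCAL INPUT `a_q(g) ≡ q (mod 𝔪)`
  (so that `c = a_q(g)/q ≡ 1`; IN PRINT: `E(ℚ_q)[3] ≠ 0` at IV/IV*, so `ρ̄|_{D_q}` has trivial inertia-fixed line and
  quotient `χ`, and `ρ_g|_{D_q}` Steinberg gives `a_q(g) = ε(Frob_q) ≡ χ(Frob_q)⁻¹ ≡ q` — local–global compatibility,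
  Carayol 1986) + Condition 1 ×2 + the non-degeneracy `Ω`; ★ `stub_nonAdditive_covered_of_vatsal_of_levelLoweredNewform_of_dvd`
  — the registered stub on its COVERED rows whose Tamagawa-`3` prime is additive.

`q ≠ 3` is derived (if `3 ∣ N_E` the non-additive row is multiplicative at `3`, where `a₃(E) = ±1 ≠ 0`), so `‖q‖₃ = 1`
and `c − 1 = (a_q(g) − q)/q`. Nothing booked; BSD is not proved by any of this.

## References

* V. Vatsal, Duke Math. J. 98 (1999), §1 (1.6), Thm. (1.13) [Vatsal1999]; R. Greenberg, V. Vatsal, Invent. Math. 142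
  (2000), §3 (17)–(19) [GreenbergVatsal2000]; K. A. Ribet, Invent. Math. 100 (1990), Thm. 1.1 [Ribet1990].
* F. Diamond, J. Shurman (2005), §5.7, Prop. 5.2.2, Prop. 5.8.5 [DiamondShurman2005]; G. Shimura (1971), Thm. 3.48
  [Shimura1971]; X. Yan, X. Zhu, Thm. 4.15 [YanZhu2024MainConjNonCM]; C. Skinner (2016), Thm. C [Skinner2016PacificMC];
  B. Mazur (1978), Cor. 4.1 [Mazur1978]; C.-H. Kim (2022/2026), Conj. 1.10 [Kim2022StructureSelmer].
-/

set_option autoImplicit false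
-- the Theorems namespace of a single-conjunct summit repeats the summit name by design (D-0017)
set_option linter.dupNamespace false

noncomputable section

open scoped MatrixGroups ModularForm Classical NNReal

open CongruenceSubgroup WeierstrassCurve Literature.NumberTheory.EllipticCurves
  Literature.NumberTheory.EllipticCurves.ModularForms
open UpperHalfPlane hiding I

namespace Summit.BirchSwinnertonDyer.BirchSwinnertonDyer.Theorems.KimAtThreeDeepLowerOffStratumLevelLoweringVatsalStabAdditive

open Summit.BirchSwinnertonDyer.BirchSwinnertonDyer.Theorems.KimAtThreeDeepLowerOffStratumLevelLoweringVatsal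
open Summit.BirchSwinnertonDyer.BirchSwinnertonDyer.Theorems.KimAtThreeDeepLowerOffStratumLevelLoweringVatsalRows
open Summit.BirchSwinnertonDyer.BirchSwinnertonDyer.Theorems.KimAtThreeDeepLowerOffStratumLevelLoweringVatsalStab
open Summit.BirchSwinnertonDyer.BirchSwinnertonDyer.Theorems.KimAtThreeDeepLowerOffStratumLevelLoweringVatsalStabRows

/-! ### §1 `U_q` kills the `U_q`-depleted old form `ι₁ g − a_q(g)·ι_q g` when `q` divides the level of `g` -/

section Hecke

variable {M q : ℕ} [NeZero M] [NeZero q] [NeZero (M * q)] {g : CuspForm (Gamma0 M) 2} (hg : IsNewform0 g)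
  (h1 : M * 1 ∣ M * q) (hMq : M * q ∣ M * q)
include hg

/-- **`U_q (ι₁ g − a_q(g) ι_q g) = 0` at level `Mq` when `q ∣ M`**: `aₙ(U_q g') = a_{qn}(g) − a_q(g) aₙ(g) = 0` since
`U_q g = a_q(g) g` at level `M ∋ q` (`a_q aₙ = a_{qn}`, no correction term).
[cite: DiamondShurman2005, Prop. 5.2.2(a) and §5.7] -/
theorem heckeT_stab_self_of_dvd (hq : q.Prime) (hqM : q ∣ M) :
    heckeT (Gamma0 (M * q)) 2 q (iota M (M * q) 1 2 h1 g - cuspCoeff g q • iota M (M * q) q 2 hMq g) =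
      (0 : ℂ) • (iota M (M * q) 1 2 h1 g - cuspCoeff g q • iota M (M * q) q 2 hMq g) := by
  set g' := iota M (M * q) 1 2 h1 g - cuspCoeff g q • iota M (M * q) q 2 hMq g with hg'
  rw [zero_smul]
  refine eq_zero_of_qExpansion_coeff_eq_zero_level0 _ fun n => ?_
  rw [qExpansion_coeff_heckeT_holds (M * q) 2 g' q hq n, if_pos (dvd_mul_left q M), add_zero]
  have hco : ∀ m : ℕ, (qExpansion 1 ⇑g').coeff m =
      cuspCoeff g m - cuspCoeff g q * (if q ∣ m then cuspCoeff g (m / q) else 0) :=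
    fun m => cuspCoeff_stab g (cuspCoeff g q) h1 hMq m
  rw [hco, if_pos (dvd_mul_right q n), Nat.mul_div_cancel_left _ hq.pos]
  have R := cuspCoeff_mul_cuspCoeff hg hq n
  rw [if_pos hqM, add_zero] at R
  rw [← R, sub_self]

/-- The depleted form is a Hecke eigenform at level `Mq` (`T_ℓ`: `heckeT_stab_of_ne`; `U_q`: eigenvalue `0`).
[cite: DiamondShurman2005, §5.7 and Prop. 5.8.5] -/
theorem isHeckeEigenform_stab_of_dvd (hq : q.Prime) (hqM : q ∣ M) :
    IsHeckeEigenform (iota M (M * q) 1 2 h1 g - cuspCoeff g q • iota M (M * q) q 2 hMq g) := by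
  intro ℓ hℓ
  haveI : NeZero ℓ := ⟨hℓ.ne_zero⟩
  by_cases hℓq : ℓ = q
  · subst hℓq
    exact ⟨_, heckeT_stab_self_of_dvd hg h1 hMq hq hqM⟩
  · exact ⟨_, heckeT_stab_of_ne hg (cuspCoeff g q) h1 hMq hq hℓ hℓq⟩

omit [NeZero (M * q)] in
/-- For `β ∈ K_g` (e.g. `β = a_q(g)`) the coefficient field of `ι₁ g − β ι_q g` lies in the number field `K_g`
(`IsNewform0.finiteDimensional_coeffField_holds`). [cite: Shimura1971, Thm. 3.48] -/
theorem finiteDimensional_coeffField_stab_of_mem {β : ℂ} (hβ : β ∈ coeffField g) :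
    FiniteDimensional ℚ (coeffField (iota M (M * q) 1 2 h1 g - β • iota M (M * q) q 2 hMq g)) := by
  haveI : FiniteDimensional ℚ (coeffField g) := IsNewform0.finiteDimensional_coeffField_holds hg
  have hle : coeffField (iota M (M * q) 1 2 h1 g - β • iota M (M * q) q 2 hMq g) ≤ coeffField g := by
    rw [coeffField, IntermediateField.adjoin_le_iff]
    rintro _ ⟨n, rfl⟩
    show (qExpansion 1 ⇑(iota M (M * q) 1 2 h1 g - β • iota M (M * q) q 2 hMq g)).coeff n ∈ coeffField g
    have hco := cuspCoeff_stab g β h1 hMq n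
    rw [cuspCoeff] at hco
    rw [hco]
    refine sub_mem (coeff_mem_coeffField g n) (mul_mem hβ ?_)
    split_ifs
    · exact coeff_mem_coeffField g _
    · exact zero_mem _
  exact FiniteDimensional.of_injective (IntermediateField.inclusion hle).toLinearMap
    (IntermediateField.inclusion_injective hle)

end Hecke

/-! ### §2 (LL_1) over `𝓀` and the COVERED 19679 rows from a level-`M` newform, `q ∣ M` (the Tamagawa-`3`
prime `q` ADDITIVE for `E`, Kodaira IV/IV*) -/

section Rows

open Summit.BirchSwinnertonDyer.BirchSwinnertonDyer.Theorems.KimAtThreeDeepLowerOffStratumLevelLoweringRekey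
open Literature.NumberTheory.EllipticCurves.Rank1Residual Literature.NumberTheory.EllipticCurves.Rank1Residual.Typed
  Literature.NumberTheory.EllipticCurves.Skinner2016 Literature.NumberTheory.Automorphic

/-- **(LL_1) over `𝓀` from a level-`M` newform `g`, `q ∣ M` (the Tamagawa-`3` prime ADDITIVE for `E`: `a_q(E) = 0`,
`q² ∣ N_E = Mq`)**: `g' = ι₁ g − a_q(g) ι_q g` (`U_q g' = 0 = a_q(E) g'`), `Φ = plusSymbol g`, `c = a_q(g)/q`, which is
`≡ 1` under the DISPLAYED local input `a_q(g) ≡ q (mod 𝔪)` (IN PRINT: `ρ̄_{E,3}|_{D_q}` has the trivial character as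
its inertia-fixed line — `E(ℚ_q)[3] ≠ 0` at Kodaira IV/IV* — and quotient `χ`, while `ρ_g|_{D_q}` is Steinberg with
unramified quotient `ε`, `ε(Frob_q) = a_q(g)`; so `a_q(g) = ε(Frob_q) ≡ χ(Frob_q)⁻¹ ≡ q`, Langlands–Carayol
local–global compatibility). Named facts: Vatsal 1999 / Greenberg–Vatsal 2000. [cite: Vatsal1999, §1 (1.6), Thm. (1.13)]
[cite: GreenbergVatsal2000, §3 (17)–(19)] [cite: DiamondShurman2005, §5.7 and Prop. 5.8.5] -/
theorem isStabilisedLevelLoweringCongruenceIn_three_of_levelLoweredNewform_of_dvd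
    (hV : vatsal1999_plusSymbol_congruence) (hGV : greenbergVatsal2000_plusSymbol_congruence)
    (W₀ : WeierstrassCurve ℚ) [W₀.IsElliptic] [W₀.IsGloballyMinimal]
    (htower : ∀ n : ℕ, W₀.HasSurjectiveModNGaloisRep (3 ^ n : ℕ)) {M q : ℕ} [NeZero M] [NeZero q] (hq : q.Prime)
    [NeZero (M * q)] (hN : M * q = W₀.conductorNorm ℤ) (D₀ : ModularParametrizationData W₀ (M * q))
    (hint : ∀ r : ℚ, ratPlusSymbol D₀.f r ≠ 0 → 0 ≤ padicValRat 3 (ratPlusSymbol D₀.f r))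
    (hnA : ¬ (haveI : Fact (Nat.Prime 3) := ⟨Nat.prime_three⟩; Addv W₀ 3))
    (hfq : W₀.LFunction q = 0)
    (ι : PadicAlgCl 3 ≃+* ℂ) {g : CuspForm (Gamma0 M) 2} (hg : IsNewform0 g) (hqM : q ∣ M)
    (hcℓ : ∀ ℓ : ℕ, ℓ.Prime → ℓ ≠ q → Valued.v (ι.symm (cuspCoeff D₀.f ℓ - cuspCoeff g ℓ)) < 1)
    (haq : Valued.v (ι.symm (cuspCoeff g q - q)) < 1)
    (hfC : HasSimpleHeckeGenEigenspace D₀.f)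
    (hgC : HasSimpleHeckeGenEigenspace
      (iota M (M * q) 1 2 (mul_dvd_mul_left M (one_dvd q)) g - cuspCoeff g q • iota M (M * q) q 2 dvd_rfl g))
    {Ω : ℂ} (hΩint : ∀ x : ℚ, Valued.v (ι.symm (plusSymbol g x / Ω)) ≤ 1)
    (hΩunit : ∃ x₀ : ℚ, Valued.v (ι.symm ((plusSymbol g x₀ - cuspCoeff g q / q * plusSymbol g (q * x₀)) / Ω)) = 1) :
    ∃ π : ZMod 3 →+* IsLocalRing.ResidueField (Valued.integer (PadicAlgCl 3)),
      IsStabilisedLevelLoweringCongruenceIn W₀ 3 1 D₀.f q π := by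
  haveI : Fact q.Prime := ⟨hq⟩
  set h1 : M * 1 ∣ M * q := mul_dvd_mul_left M (one_dvd q) with hh1
  set β : ℂ := cuspCoeff g q with hβdef
  set g' := iota M (M * q) 1 2 h1 g - β • iota M (M * q) q 2 dvd_rfl g with hg'def
  have hf := D₀.isNewformOf
  -- `q ≠ 3`: `3 ∣ N_E` would make `E` multiplicative at `3` (`¬ Addv`), where `a₃(E) = ±1 ≠ 0`
  have hq3 : q ≠ 3 := by
    rintro rfl
    haveI : Fact (Nat.Prime 3) := ⟨Nat.prime_three⟩
    have h3N : 3 ∣ W₀.conductorNorm ℤ := hN ▸ dvd_mul_left 3 M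
    have hng : ¬ W₀.HasGoodReductionAtPrime 3 := (W₀.dvd_conductorNorm_iff_not_hasGoodReductionAtPrime 3).mp h3N
    have hmult : W₀.HasMultiplicativeReductionAtPrime 3 := by
      by_contra hm
      exact hnA ⟨hng, hm⟩
    have hsq := (LFunction_prime_pow_of_hasMultiplicativeReductionAtPrime W₀ 3 hmult 0).2
    rw [hfq] at hsq
    norm_num at hsq
  -- `β = a_q(g)` is integral; `c = β/q ≡ 1`
  have hβint : Valued.v (ι.symm β) ≤ 1 := valuation_cuspCoeff_le_one_of_isNewform0 hg ι q
  have hqnorm : ‖(q : PadicAlgCl 3)‖ = 1 :=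
    Literature.NumberTheory.GaloisRepresentations.PadicAlgCl.norm_natCast_of_not_dvd
      (fun h => hq3 ((Nat.prime_dvd_prime_iff_eq Nat.prime_three hq).mp h).symm)
  have hc : Valued.v (ι.symm (β / q - 1)) < 1 := by
    refine valuation_lt_one_iff.mpr ?_
    have hq0 : (q : PadicAlgCl 3) ≠ 0 := fun h => by rw [h, norm_zero] at hqnorm; exact zero_ne_one hqnorm
    have : ι.symm (β / q - 1) = ι.symm (β - q) / q := by
      rw [map_sub, map_one, map_div₀, map_natCast, map_sub, map_natCast]
      field_simp
    rw [this, norm_div, hqnorm, div_one]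
    exact valuation_lt_one_iff.mp haq
  -- congruence for ALL `n`
  have hfq' : cuspCoeff D₀.f q = 0 := by rw [hf.2 q, hfq, Int.cast_zero]
  have hgint' : ∀ n : ℕ, Valued.v (ι.symm (cuspCoeff g' n)) ≤ 1 := by
    intro n
    rw [cuspCoeff_stab, map_sub, map_mul, sub_eq_add_neg]
    refine valuation_le_one_iff.mpr ((PadicAlgCl.isNonarchimedean 3 _ _).trans (max_le ?_ ?_))
    · exact valuation_le_one_iff.mp (valuation_cuspCoeff_le_one_of_isNewform0 hg ι n)
    · rw [norm_neg, norm_mul]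
      refine mul_le_one₀ (valuation_le_one_iff.mp hβint) (norm_nonneg _) ?_
      by_cases hqn : q ∣ n
      · rw [if_pos hqn]; exact valuation_le_one_iff.mp (valuation_cuspCoeff_le_one_of_isNewform0 hg ι _)
      · rw [if_neg hqn, map_zero, norm_zero]; exact zero_le_one
  have hcong : ∀ n : ℕ, Valued.v (ι.symm (cuspCoeff D₀.f n - cuspCoeff g' n)) < 1 := by
    refine valuation_cuspCoeff_sub_lt_one_of_prime ι hf.1.2.1 (isHeckeEigenform_stab_of_dvd hg h1 dvd_rfl hq hqM)
      hf.1.2.2 (isNormalized_stab g β h1 dvd_rfl hg.2.2 hq) (valuation_cuspCoeff_le_one_of_isNewformOf W₀ hf ι)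
      hgint' fun ℓ hℓ => ?_
    rw [cuspCoeff_stab_prime hg β h1 dvd_rfl hq hℓ]
    by_cases hℓq : ℓ = q
    · subst hℓq
      rw [if_pos rfl, hfq', hβdef, sub_self, sub_zero, map_zero, Valuation.map_zero]
      exact zero_lt_one
    · rw [if_neg hℓq]
      exact hcℓ ℓ hℓ hℓq
  -- the plus symbol `Φ = plusSymbol g`: eigenvalues `a_ℓ(g) ≡ a_ℓ(E)` at `ℓ ∤ 3N_E`, Hecke relations, periodicity
  have hb : ∀ ℓ : ℕ, ℓ.Prime → ¬ ℓ ∣ W₀.conductorNorm ℤ * 3 →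
      Valued.v (ι.symm (cuspCoeff g ℓ - (W₀.frobeniusTrace ℓ : ℂ))) < 1 := by
    intro ℓ hℓ hℓN3
    haveI : Fact ℓ.Prime := ⟨hℓ⟩
    have hℓN : ¬ ℓ ∣ W₀.conductorNorm ℤ := fun h => hℓN3 (h.mul_right 3)
    have hℓq : ℓ ≠ q := by rintro rfl; exact hℓN (hN ▸ dvd_mul_left ℓ M)
    have hfℓ : cuspCoeff D₀.f ℓ = (W₀.frobeniusTrace ℓ : ℂ) := by
      rw [hf.2 ℓ, LFunction_apply_prime_eq_frobeniusTrace W₀ ℓ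
        (hasGoodReductionAtPrime_of_not_dvd_conductorNorm W₀ hℓN)]
    rw [← hfℓ, ← Valuation.map_neg, ← map_neg, neg_sub]
    exact hcℓ ℓ hℓ hℓq
  have hΦhecke : ∀ ℓ : ℕ, ℓ.Prime → ¬ ℓ ∣ W₀.conductorNorm ℤ * 3 → ∀ x : ℚ,
      cuspCoeff g ℓ * plusSymbol g x = (∑ j : Fin ℓ, plusSymbol g ((x + j) / ℓ)) + plusSymbol g (ℓ * x) := by
    intro ℓ hℓ hℓN3 x
    haveI : NeZero ℓ := ⟨hℓ.ne_zero⟩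
    have hℓM : ¬ ℓ ∣ M := fun h => hℓN3 ((hN ▸ h.mul_right q).mul_right 3)
    exact cuspCoeff_mul_plusSymbol ℓ hg hℓ hℓM x
  have hΦper : ∀ x : ℚ, plusSymbol g (x + 1) = plusSymbol g x := by
    intro x
    have h₁ := modularSymbol_add_intCast_holds g x 1
    have h₂ := modularSymbol_add_intCast_holds g (-x) (-1)
    simp only [plusSymbol]
    rw [show -(x + 1) = -x + ((-1 : ℤ) : ℚ) by push_cast; ring, h₂, show x + 1 = x + ((1 : ℤ) : ℚ) by push_cast; ring,
      h₁]
  exact isStabilisedLevelLoweringCongruenceIn_three_of_not_addv hV hGV W₀ htower (N := M * q) hN D₀ hint hnA ι g'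
    q hfC (isHeckeEigenform_stab_of_dvd hg h1 dvd_rfl hq hqM) (isNormalized_stab g β h1 dvd_rfl hg.2.2 hq)
    (finiteDimensional_coeffField_stab_of_mem hg h1 dvd_rfl (coeff_mem_coeffField g q)) hgint' hgC hcong (plusSymbol g)
    (β / q) (fun ℓ => cuspCoeff g ℓ) (plusSymbol_stab g β h1 dvd_rfl) hc hΦper hb hΦhecke hΩint hΩunit

/-- ★ **`stub_nonAdditive` on its COVERED rows with `v₃(∏ c_ℓ) ≤ 1` whose Tamagawa-`3` prime `q` is ADDITIVE for `E`
(`a_q(E) = 0`; Kodaira IV/IV*), from VATSAL / GREENBERG–VATSAL BY NAME and a level-`N/q` NEWFORM `g` (`q ∣ N/q`)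
congruent to `D₀.f` at the primes `ℓ ≠ q`**, with the displayed local input `a_q(g) ≡ q`, Condition 1 ×2 and the
non-degeneracy `Ω` (cf. `…VatsalStabRows` for the split-multiplicative case). [cite: Vatsal1999, §1 (1.6), Thm. (1.13)]
[cite: GreenbergVatsal2000, §3 (17)–(19)] [cite: Ribet1990, Thm. 1.1] [cite: YanZhu2024MainConjNonCM, Thm. 4.15 (§4.6)]
[cite: Skinner2016PacificMC, Thm. C (§1)] [cite: Mazur1978, Cor. 4.1] [cite: Kim2022StructureSelmer, Conj. 1.10 (PDF p. 8)] -/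
theorem stub_nonAdditive_covered_of_vatsal_of_levelLoweredNewform_of_dvd
    (hV : vatsal1999_plusSymbol_congruence) (hGV : greenbergVatsal2000_plusSymbol_congruence)
    (hYZ : YanZhu2026.thm415_padicValRat_bsd_rank_le_one)
    (hW20 : Wuthrich2014.lemma20_surjective_threeAdic_of_semistable)
    (hSk : Skinner2016.thmC_padicValRat_bsd_rank_zero)
    (hmod : hasEntireLFunction_rat) (hGZK : rank_eq_analyticRank_of_analyticRank_le_one)
    (hM : mazur_not_dvd_maninConstant_of_odd) :
    ∀ (W₀ : WeierstrassCurve ℚ) [W₀.IsElliptic] [W₀.IsGloballyMinimal],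
      (∀ n : ℕ, W₀.HasSurjectiveModNGaloisRep (3 ^ n : ℕ)) → Finite W₀.sha →
      ∀ {M q : ℕ} [NeZero M] [NeZero q] [Fact q.Prime] [NeZero (M * q)], M * q = W₀.conductorNorm ℤ →
      ∀ (D₀ : ModularParametrizationData W₀ (M * q)),
        (∀ z ∈ D₀.L.lattice, ∃ w ∈ periodLattice D₀.f, z = D₀.c * w) →
        (∀ (W₂ : WeierstrassCurve ℚ) [W₂.IsElliptic] (D₂ : ModularParametrizationData W₂ (M * q)),
          D₂.f = D₀.f → D₀.modularDegree ≤ D₂.modularDegree) →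
        (∀ r : ℚ, ratPlusSymbol D₀.f r ≠ 0 → 0 ≤ padicValRat 3 (ratPlusSymbol D₀.f r)) →
        kuriharaVanishingOrder W₀ 3 D₀.f = 0 →
        ¬ (haveI : Fact (Nat.Prime 3) := ⟨Nat.prime_three⟩; Addv W₀ 3) →
        (W₀.HasGoodReductionAtPrime 3 → ¬ (3 : ℤ) ∣ W₀.frobeniusTrace 3) →
        (W₀.HasMultiplicativeReductionAtPrime 3 →
          (haveI : Fact (Nat.Prime 3) := ⟨Nat.prime_three⟩; Ram W₀ 3)) →
        padicValNat 3 W₀.tamagawaProduct ≤ 1 →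
        W₀.LFunction q = 0 →
        ∀ (ι : PadicAlgCl 3 ≃+* ℂ) (g : CuspForm (Gamma0 M) 2), IsNewform0 g → q ∣ M →
          (∀ ℓ : ℕ, ℓ.Prime → ℓ ≠ q → Valued.v (ι.symm (cuspCoeff D₀.f ℓ - cuspCoeff g ℓ)) < 1) →
          Valued.v (ι.symm (cuspCoeff g q - q)) < 1 →
          HasSimpleHeckeGenEigenspace D₀.f →
          HasSimpleHeckeGenEigenspace
            (iota M (M * q) 1 2 (mul_dvd_mul_left M (one_dvd q)) g - cuspCoeff g q • iota M (M * q) q 2 dvd_rfl g) →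
        ∀ (Ω : ℂ), (∀ x : ℚ, Valued.v (ι.symm (plusSymbol g x / Ω)) ≤ 1) →
          (∃ x₀ : ℚ, Valued.v (ι.symm ((plusSymbol g x₀ - cuspCoeff g q / q * plusSymbol g (q * x₀)) / Ω)) = 1) →
        ∃ d : ℕ, kuriharaPartialDeepInfty W₀ 3 D₀.f = d ∧
          kuriharaPartial W₀ 3 D₀.f 0 ≤
            ((padicValNat 3 (Nat.card (AddCommGroup.primaryComponent W₀.sha 3)) + d : ℕ) : ℕ∞) := by
  intro W₀ _ _ htower hfin M q _ _ _ _ hN D₀ hopt hdeg hint hord hnA hordinary hram hv hfq ι g hg hqM hcℓ haq hfC hgC Ω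
    hΩint hΩunit
  obtain ⟨π, hLL⟩ := isStabilisedLevelLoweringCongruenceIn_three_of_levelLoweredNewform_of_dvd hV hGV W₀ htower Fact.out hN
    D₀ hint hnA hfq ι hg hqM hcℓ haq hfC hgC hΩint hΩunit
  exact stub_nonAdditive_covered_of_isStabilisedLevelLoweringCongruenceIn hYZ hW20 hSk hmod hGZK hM W₀ htower hfin hN
    D₀ hopt hdeg hint hord hnA hordinary hram hv π q (hN ▸ dvd_mul_left q M) hLL

end Rows

end Summit.BirchSwinnertonDyer.BirchSwinnertonDyer.Theorems.KimAtThreeDeepLowerOffStratumLevelLoweringVatsalStabAdditive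

end
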